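import Summits.HodgeConjecture.HodgeConjecture.Theorems.F0P3LettersXiLocalPacketUnitary   -- ★ p823308: the LETTER `XiLocalPacketUnitary` (proved here BY NAME)
import Summits.HodgeConjecture.HodgeConjecture.Theorems.F0P3bSplitMemberUnitarizable     -- ★ p825402: clause (i) `splitMemberGL_isUnitarizable`
import Summits.HodgeConjecture.HodgeConjecture.Theorems.F0P3bSupercuspidalUnitarizable    -- ★ p825442: clause (iii) `isUnitarizable_of_isSupercuspidal`
import Summits.HodgeConjecture.HodgeConjecture.Theorems.F0P3bLocalNonsplitCompactCenter    -- ★ p825600: frame `local_nonsplit_compactOpen_center_of_center_le`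
import Literature.NumberTheory.Automorphic.LocalUnitaryGroupCenter                        -- ★ `forall_mem_center_cmLocal_eq_scalar` («central ⇒ scalar», non-split `v`)
import Literature.NumberTheory.GelbartRogawski1991.XiLocalPacketNonsplitThetaPair         -- ★ p826161: letter D `xiLocalPacket_nonsplit_isThetaPair` + ED. 2 `.pin_of_keysLabels`
import Summits.HodgeConjecture.HodgeConjecture.Theorems.F0P2iGRDWitness                   -- ★ the dictionary pair `(grdMu, grdChi)` of the finite GR dictionary
import Summits.HodgeConjecture.HodgeConjecture.Theorems.F0P3LocalConstituentsUnitary       -- ★ `isUnitarizable_of_injective`, `isUnitarizable_comp`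
import Literature.NumberTheory.Automorphic.Liu2021.Def411WeilCarriersSurvivalNonsplit     -- ★ `compactSpace_localPi_one_of_smul_eq`, `continuous_localCenter`
import Literature.RepresentationTheory.TwistedCoinvariantsCompactIsotypic                 -- ★ `exists_linearEquiv_weightSpace_coinv` (road of stub U1b)
import Summits.HodgeConjecture.HodgeConjecture.Theorems.F0P3bOmegaLocUnitarizable        -- ★ p830233 (B-p12 (g26)): U1a′ `isUnitarizable_omegaLoc_chiLocalSplittingsCM` — `ω_v` of the CM splitting package is unitarizable at a unitary `θ`
import Literature.RepresentationTheory.TwistedCoinvariantsUnitarizable                     -- ★ p829818 (B-p12 (g26)): `TwistedCoinv.isUnitarizable_rep` CLOSES stub U1b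
import Summits.HodgeConjecture.HodgeConjecture.Theorems.F0P2oLocalLettersHold             -- ★ p839396 (F0P2-p02 (g7)): `xiLocalPacket_nonsplit_isThetaPair_holds` CLOSES stub D (ED. 5) — HYPOTHESIS-FREE over the ★ N3 closer
import HarnessLib

/-!
# F0 ∕ P3b — PAY-DOWN LINE L1′ «KeysPnUnitary»: the RESIDUAL (ii) of `Lines/F0_P3b_XiLocalPacketUnitaryPaydown.lean` ED. 5 by the THETA ROAD
# (cell `hodgecm-mathlib`, crux H413, programme P3b; planner `hodgecm-mathlib-F0P3b-plan-g9`, gen 9; ED. 5 `hodgecm-mathlib-F0P3b-plan-g11`, gen 11 — NO `sorry` LEFT)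

WHAT THIS FILE IS.  A REGISTERED pay-down line (F0 §3a: `Cruxes/H413/Lines/`, stubs = `sorry`, kernel-checked composition; NOT a skeleton of record —
the crux's skeleton of record stays `Lines/a3_liu413.lean`).  Its target is the ONE remaining `sorry` of the sister line L1
`Lines/F0_P3b_XiLocalPacketUnitaryPaydown.lean` ED. 5, the residual (ii) `stub_keysPn_isUnitarizable` — «at a finite place `v` of `L⁺` NON-split in `L`, the
Keys-labelled non-tempered member `πⁿ(ξ_v)` of the packet of record (the second component of the junction's `keys ξ v hns`) is UNITARIZABLE» — which L1 left
CITED ([Rogawski1990 §12.2 (2) p. 174], [Keys1984]: `πⁿ(ξ_v)` is the endpoint of a complementary series).  HERE it is CUT, not cited: `πⁿ(ξ_v)` is a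
`U(3) × U(1)` THETA TYPE (letter D ★ p826161 `GelbartRogawski1991.xiLocalPacket_nonsplit_isThetaPair`, ED. 2 `.pin_of_keysLabels` — topic T7, paid by the
registered T7b tree), and a theta type is unitarizable because the local Weil representation is (Schrödinger model, `L²` pairing) and twisted coinvariants
by the COMPACT centre `U(1)(L⁺_v) = L_w¹` (non-split `v`!) of a smooth unitarizable representation are unitarizable (they are a sub-quotient realised INSIDE:
the `χ`-isotypic subspace, ★ `TwistedCoinv.exists_linearEquiv_weightSpace_coinv`).

THE HEAD (proved BY NAME, no new letter, no new `def`): for every CM frame `(L, H, hH, hHd, μω, hμu, μZ, keys)` of the letter ★ `XiLocalPacketUnitary`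
(`Theorems/F0P3LettersXiLocalPacketUnitary.lean` :52–72) — under the two extras the K9β junction ALREADY holds (`Lines/F0_U3LettersRung1.lean` ED. 4:
the global binder `hμω : μω|_{𝕀_{L⁺}} = ω_{L/L⁺}` :1070–1080, and the `borel ∕ BorelSpace ∕ IsHaarMeasure` instances on `U(Φ₃)(L⁺_v) ⧸ Z` of the kit measure
`C.W.μZ` :768–770) —
  `xiLocalPacketUnitary_of_line L H hH hHd μω hμu hres μZ keys : XiLocalPacketUnitary L H hH hHd μω hμu μZ keys`.
Clause (i) = ★ p825402, clause (iii) = ★ p825442 at the frame ★ p825600 + ★ `forall_mem_center_cmLocal_eq_scalar` (L1 ED. 5 §2 verbatim), clause (ii) = §3 below.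

THE (ii) ROAD (§3, kernel-checked):  fix `ξ`, a non-split `v` (`hns`), the Keys pair `(π², πⁿ) := (keys ξ v hns).1` with its labels `(keys ξ v hns).2`.
 1. FRAME for `Φ₃ = qsForm L` (§2 `exists_qsFrame`, proved): the rational diagonalising frame `S = (e₁+e₃ | e₂ | e₁−e₃)`, `ᵗS̄ Φ₃ S = diag(2, 1, −2)`.
 2. DICTIONARY (★ `F0P2iGRDWitness`): `μ := grdMu L ξ μω hμu` (conjugate-symplectic under `hres`, ★ `isConjugateSymplectic_grdMu`), `χ_f := grdChi L ξ μω hres`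
    (continuous, unitary, ★), on the two dictionary pins ★ `semilocalComponent_toHeckeCharacter_grdMu`, ★ `grdChi_finAdelicCheck`.
 3. LETTER D at the label (★ ED. 2 `.pin_of_keysLabels`, form congruence `T = 1`, `a = 1`, ★ `formCongr_one_eq`): `∃ εn, ThetaTypeAtCM L Φ₃ e₁ dV₀ … S … μ … χ_f εn v (πⁿ ∘ e)`.
 4. `X_v(μ, εn, χ_f)` (★ `xThetaCM`) is UNITARIZABLE (§3 `xThetaCM_isUnitarizable`): ★ `isUnitarizable_comp` ∘ STUB U1b (twisted coinvariants by the compact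
    smooth centre; compactness ★ `compactSpace_localPi_one_of_smul_eq` at `hns`, smoothness ★ `isSmooth_omegaLoc` + ★ `continuous_localCenter`) ∘ STUB U1a′
    (`ω_v` unitarizable at the unitary splitting character `θ = μ̃`, ★ `isUnitary_toHeckeCharacter`).
 5. THETA TYPE ⇒ UNITARIZABLE (§2 `isUnitarizable_of_isIrreducible_of_isotypicComponent_eq_top`, PROVED, generic: an irreducible `τ` whose `ℂ[G]`-module is
    `X′`-isotypic with `X′` unitarizable is unitarizable — `τ` simple, a submodule `≅ X′` is `⊤`, transport along ★ `isUnitarizable_of_injective`), read at a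
    representative of `πⁿ ∘ e ∘ localPiEquiv` (★ `IrrClass.mk_surjective`, ★ `isConstituentOf_mk_self`, self-isotypy §2) — then back along the two
    isomorphisms (★ `isUnitarizable_comap`, ★ `IrrClass.comap_symm_comap`, ★ `IrrClass.comap_comap_symm`).

STUBS (NO `sorry` LEFT since ED. 5: D is CLOSED by ★ p839396 `F0P2oLocalLettersHold.xiLocalPacket_nonsplit_isThetaPair_holds` (F0P2-p02 (g7), hypothesis-free over the ★ N3 closer
`F0P2oLineJacquetHolds.thetaType_nonsplit_jacquetModule_holds`); U1b by ★ p829818 (ED. 3) and U1a′ by ★ p830233 (ED. 4), both B-p12 (g26); F0 §3a∕§9: each closes by ONE accepted file, none restates (ii), the letter, or the summit; statements unchanged at every edition):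
* `stub_GR91_localThetaPair : xiLocalPacket_nonsplit_isThetaPair` — LETTER D ★ p826161 BY NAME — CLOSED at ED. 5 by ★ p839396 `Theorems/F0P2oLocalLettersHold.lean`
  `xiLocalPacket_nonsplit_isThetaPair_holds` (#104∕#75-loc HYPOTHESIS-FREE: ★ p837697 `…_of_N3` at the ★ N3 closer (JA) `F0P2oLineJacquetHolds`; the T7 road K1⁺∕K3∕LABEL∕N3 of record);
* `stub_isUnitarizable_omegaLocCM` (U1a′, in-house, S–M) — CLOSED at ED. 4 by ★ p830233 `F0P3bOmegaLocUnitarizable.isUnitarizable_omegaLoc_chiLocalSplittingsCM` (B-p12 (g26); generic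
  ★ `Representation.IsL2Isometric.isUnitarizable`, `Literature/NumberTheory/Automorphic/SchwartzBruhatL2Unitarizable.lean`) — the local Weil representation `ω_v` of the CM splitting package at a UNITARY splitting character is
  unitarizable (the `L²(X)` inner product on the Schrödinger model `𝓢(L⁺_vⁿ′)`; road: ★ `isL2Isometric_omegaLoc_congrW_undoubledSplittings_cmFinLocalFamily` +
  ★ `Representation.IsL2Isometric.integral_mul_conj_apply`, positivity of Haar measure on open sets) [MoeglinVignerasWaldspurger1987 Ch. 2 II.1–II.2; Kudla1994 §1];
* `stub_isUnitarizable_twistedCoinv` (U1b, GENERIC) — CLOSED at ED. 3 by ★ p829818 `TwistedCoinv.isUnitarizable_rep` (B-p12 (g26)) — for `H` COMPACT acting SMOOTHLY (`ρW`) and commuting with a unitarizable `ρV` of `G`, the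
  `G`-representation on the `χ`-coinvariants `TwistedCoinv.rep χ ρV hc` is unitarizable (if `ker χ` is open: ★ `TwistedCoinv.exists_linearEquiv_weightSpace_coinv`
  identifies the coinvariants with the `χ`-isotypic SUBSPACE, `ρV`-stable by ★ `map_weightSpace_le`, and ★ `isUnitarizable_of_injective` restricts the form; if not,
  every smooth vector dies in the coinvariants, which are `0`) [BernsteinZelevinsky1976 §2.3; MVW87 Ch. 2 II.2].
Why 3 stubs and not 5–7 (PLAN v10 §2 budget): T3's Keys facts enter through the frame's `keys` (the junction feeds `keysOfKeysCaseTwo (stub_Keys L)`), so no Keys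
stub is re-asked here; the square-integrability label is consumed by the letter's ED. 2 projection; the measure is the junction's Haar measure (no SQ∕Haar-existence
stub).  Books effect: K9β row #10 `StubXLPU` (k = 1 open slot = (ii)) RETIRES in favour of {letter D (already booked, T7b)} + 2 in-house stubs — 0 new letters.

K9β ED. 6 HUNK (proposal to F0P3-plan ∕ REF1 ∕ director, not written here): at the junction `:1405`
`stub_XLPU L H (transpose_map_cmConjRingHom_eq_of_frame L ι H T hT) (isUnit_det_of_frame L ι H T hT) μω hμu C.W.μZ (keysOfKeysCaseTwo …)` ↦
`F0P3bKeysPnUnitaryPaydown.xiLocalPacketUnitary_of_line L H (…) (…) μω hμu hμω C.W.μZ (keysOfKeysCaseTwo …)` (instances from the `haveI`s :768–770).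
L1 ED. 5's `stub_keysPn_isUnitarizable` AS TYPED (arbitrary measure `μZ`, no `hres`) is NOT claimed provable by this road and stays the record of what was cited.

DEF∕PROOF discipline: theorems only except the ONE Prop-valued closed form `XiLocalPacketUnitaryOfLineClosed` of §5 (RULING (V46)∕(V47); no data `def`, no instance,
no notation, no `set_option allowUnsafeReducibility`); NO `sorry` since ED. 5 (the three `stub_*` keep their names and statements and are now PROVED by ★ names);
checked BY IMPORT of ★ modules only (`lean check --json --no-snap`); `--axioms` of the head = the TRIO {propext, Classical.choice, Quot.sound} (ED. 5; `sorryAx` gone).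
HONEST LABEL: HC_CM is proved only modulo the 2 remaining named inputs (hLiu418, h413) — behind them the booked printed statements + the MOD package — until
rung 0 closes; with all three stubs closed (ED. 5) this file PAYS the residual (ii) of L1 inside the K9β junction's frame — one ACTIVE-list `sorry` fewer, not rung 0.

## References
* [Rogawski1990] J. Rogawski, Ann. of Math. Stud. 123: §12.2 (2) p. 174 (`πⁿ(ξ)`), §13.1 p. 199.  [Keys1984] D. Keys, Compositio Math. 51 (1984) (reducibility of
  unramified unitary principal series; the cited road NOT taken here).
* [GelbartRogawski1991] Invent. Math. 105: §1.4 pp. 450–451, (5.1.1) p. 465, Lemma 5.1.2 p. 466 (`Π(ϱ_v) = {ω(γ_v, ψ_v, χ_v)}`).  [GelbartRogawski1990] Prop. 5.2.2.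
* [MoeglinVignerasWaldspurger1987] LNM 1291, Ch. 2 II.1–II.2 (Schrödinger model, unitarity; coinvariants of compact groups), Ch. 3 IV.  [Kudla1994] Israel J. Math. 87 §1.
* [BernsteinZelevinsky1976] Russian Math. Surveys 31, §2.1–2.3.  [BushnellHenniart2006] §1.1, §2.6, §11.1.  [Liu2021] Def. 4.11; App. D §D.1.
-/

set_option autoImplicit false
set_option linter.dupNamespace false

noncomputable section

open NumberField IsDedekindDomain MeasureTheory
open Literature.NumberTheory Literature.NumberTheory.Rogawski1990 Literature.NumberTheory.GaloisRepresentations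
open Literature.NumberTheory.Automorphic Literature.NumberTheory.Automorphic.UnitaryGroup
open Literature.NumberTheory.Automorphic.IdeleClassGroup
open Literature.NumberTheory.Automorphic.Liu2021 Literature.NumberTheory.Automorphic.Liu2021.Def411WeilCarriers
open Literature.NumberTheory.Automorphic.Liu2021.Def411WeilCarriersDoubling
open Literature.NumberTheory.GelbartRogawski1991 Literature.NumberTheory.GelbartRogawski1991.UnitaryDualPair
open Literature.NumberTheory.GelbartRogawski1991.UnitaryDualPair.WeilCoinv
open Literature.NumberTheory.GelbartRogawski1991.GRConstruction
open Literature.RepresentationTheory Literature.RepresentationTheory.Liu2021 Literature.RepresentationTheory.HarrisKudlaSweet1996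
open scoped Matrix Classical

namespace Summit.HodgeConjecture.HodgeConjecture.Cruxes.H413.F0P3bKeysPnUnitaryPaydown

open Summit.HodgeConjecture.HodgeConjecture.Cruxes.H413.F0P3LettersXiLocalPacketUnitary (XiLocalPacketUnitary)
open Summit.HodgeConjecture.HodgeConjecture.Cruxes.H413.F0P3ClassTokenChoice (isUnitarizable_comap)
open Summit.HodgeConjecture.HodgeConjecture.Cruxes.H413.F0P3LocalConstituentsUnitary (isUnitarizable_of_injective isUnitarizable_comp)
open Summit.HodgeConjecture.HodgeConjecture.Cruxes.H413.F0P2iGRDWitness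

/-! ## §1 The stubs (NO `sorry` since ED. 5: D closed by ★ p839396, U1b at ED. 3, U1a′ at ED. 4 — statements unchanged) -/

/-- **STUB D — LETTER ★ p826161 BY NAME — CLOSED at ED. 5 by ★ p839396 `F0P2oLocalLettersHold.xiLocalPacket_nonsplit_isThetaPair_holds` (HYPOTHESIS-FREE, token for token;
F0P2-p02 (g7) over the ★ N3 closer): the local theta dichotomy for the true packet `Π(ξ_v) = {πⁿ(ξ_v), πˢ(ξ_v)}` at a non-split finite place** — consumed below only
through its ED. 2 projection `.pin_of_keysLabels` («the Keys-labelled `πⁿ` is the theta type `X_v(μ, εn, χ_f) ∘ κ_v⁻¹`»); statement unchanged.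
[cite: GelbartRogawski1991, Lem. 5.1.2 p. 466; §1.4 pp. 450–451; (5.1.1) p. 465; §5.2 Cor. 5.2.2 p. 467] [cite: GelbartRogawski1990, Prop. 5.2.2] [cite: Rogawski1990, §12.2 (2) p. 174] -/
theorem stub_GR91_localThetaPair : xiLocalPacket_nonsplit_isThetaPair :=
  F0P2oLocalLettersHold.xiLocalPacket_nonsplit_isThetaPair_holds

set_option synthInstance.maxHeartbeats 400000 in
set_option maxHeartbeats 8000000 in
/-- **STUB U1a′ — CLOSED at ED. 4 by ★ p830233 `Theorems/F0P3bOmegaLocUnitarizable.lean` (B-p12 (g26); `isUnitarizable_omegaLoc_chiLocalSplittingsCM`, binders and conclusion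
token for token, via the generic ★ `Representation.IsL2Isometric.isUnitarizable` + ★ `secondCountableTopology_adicCompletion`); statement unchanged — the local Weil
representation `ω_v` of the CM splitting package is UNITARIZABLE at a unitary splitting character `θ`**:
the `L²(L⁺_vⁿ′)` inner product on the Schrödinger model `𝓢(L⁺_vⁿ′)` is positive definite and `ω_v`-invariant (★ `isL2Isometric_omegaLoc_congrW_undoubledSplittings_cmFinLocalFamily`
gives the isometry for `θ` unitary; ★ `Representation.IsL2Isometric.integral_mul_conj_apply` the sesquilinear invariance; definiteness: a non-zero locally constant compactly
supported function has positive `L²`-mass for a Haar measure). [cite: MoeglinVignerasWaldspurger1987, Ch. 2 II.1–II.2] [cite: Kudla1994, §1] [cite: GelbartRogawski1991, §3.1 Prop. 3.1.1 p. 455] -/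
theorem stub_isUnitarizable_omegaLocCM (L : Type) [Field L] [NumberField L] [IsCMField L] {n' : ℕ} (e₁ : Fin 3 × Fin 1 ≃ Fin n')
    (dV : Fin 3 → L) (hdV : ∀ i, IsCMField.complexConj L (dV i) = dV i) (hdV0 : ∀ i, dV i ≠ 0)
    (θ : HeckeCharacter L) (hθ : IsSplittingChar L 1 θ) (hθu : θ.IsUnitary) (ε : (↥(maximalRealSubfield L))ˣ)
    (v : HeightOneSpectrum (𝓞 ↥(maximalRealSubfield L))) :
    ((chiLocalSplittingsCM L e₁ dV hdV hdV0 θ hθ ε).omegaLoc v).IsUnitarizable :=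
  Summit.HodgeConjecture.HodgeConjecture.Cruxes.H413.F0P3bOmegaLocUnitarizable.isUnitarizable_omegaLoc_chiLocalSplittingsCM
    L e₁ dV hdV hdV0 θ hθ hθu ε v   -- ★ p830233 (CLOSED, ED. 4)

/-- **STUB U1b — CLOSED at ED. 3 by ★ p829818 `Literature/RepresentationTheory/TwistedCoinvariantsUnitarizable.lean` (B-p12 (g26); `TwistedCoinv.isUnitarizable_rep`,
via the dichotomy `isOpen_ker_or_subsingleton_coinv` + `exists_injective_intertwiner_weightSpace`); statement unchanged — twisted coinvariants by a COMPACT group acting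
SMOOTHLY inherit unitarizability**: for `ρW : H → GL(S)` smooth with `H`
compact, a character `χ : H → ℂˣ`, and a unitarizable `ρV : G → GL(S)` commuting with `ρW(H)`, the representation `TwistedCoinv.rep χ ρV hc` of `G` on the
`χ`-coinvariants `S_{H,χ}` is unitarizable.  Road: if `ker χ` is open, ★ `TwistedCoinv.exists_linearEquiv_weightSpace_coinv` identifies `S_{H,χ}` with the `χ`-ISOTYPIC
SUBSPACE of `S` (stable under `ρV`, ★ `TwistedCoinv.map_weightSpace_le`; the identification intertwines by ★ `TwistedCoinv.rep_mk`), and ★ `isUnitarizable_of_injective`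
restricts the invariant form; if `ker χ` is not open, no open subgroup lies in `ker χ`, so every (smooth) vector has `mk v = χ(k) • mk v` with `χ(k) ≠ 1`, i.e. `S_{H,χ} = 0`.
[cite: BernsteinZelevinsky1976, §2.3] [cite: MoeglinVignerasWaldspurger1987, Ch. 2 II.2] [cite: BushnellHenniart2006, §2.6] -/
theorem stub_isUnitarizable_twistedCoinv {G H S : Type*} [Group G] [Group H] [TopologicalSpace H] [IsTopologicalGroup H] [CompactSpace H]
    [AddCommGroup S] [Module ℂ S] {ρW : Representation ℂ H S} (χ : H →* ℂˣ) (ρV : Representation ℂ G S)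
    (hc : ∀ (g : G) (h : H), Commute (ρV g) (ρW h)) (hsm : ρW.IsSmooth) (hρV : ρV.IsUnitarizable) :
    (TwistedCoinv.rep χ ρV hc).IsUnitarizable :=
  TwistedCoinv.isUnitarizable_rep χ ρV hc hsm hρV   -- ★ p829818 (CLOSED, ED. 3)

/-! ## §2 Proved generic glue: theta type ⇒ unitarizable; smoothness of a restriction; the rational frame of `Φ₃` -/

/-- **An irreducible representation whose `ℂ[G]`-module is `X′`-isotypic, with `X′` unitarizable, is unitarizable** (no irreducibility asked of `X′`):
`τ.asModule` is simple, so a submodule `m ≅ X′.asModule` is `⊥` or `⊤`; `⊥` would make `X′ = 0` and the isotypic component `⊥ ≠ ⊤`; `⊤` gives an injective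
intertwiner `τ → X′`, along which the invariant form restricts (★ `isUnitarizable_of_injective`). [cite: BourbakiAlgebreVIII2012, VIII §4 n°2] [cite: BushnellHenniart2006, §2.6] -/
theorem isUnitarizable_of_isIrreducible_of_isotypicComponent_eq_top {G V T : Type*} [Group G] [AddCommGroup V] [Module ℂ V]
    [AddCommGroup T] [Module ℂ T] {τ : Representation ℂ G T} {σ : Representation ℂ G V} (hτ : τ.IsIrreducible)
    (htop : isotypicComponent (MonoidAlgebra ℂ G) τ.asModule σ.asModule = ⊤) (hσ : σ.IsUnitarizable) : τ.IsUnitarizable := by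
  haveI : IsSimpleModule (MonoidAlgebra ℂ G) τ.asModule := (Representation.irreducible_iff_isSimpleModule_asModule τ).mp hτ
  have hne : ({m : Submodule (MonoidAlgebra ℂ G) τ.asModule | Nonempty (m ≃ₗ[MonoidAlgebra ℂ G] σ.asModule)}).Nonempty := by
    by_contra h0
    rw [Set.not_nonempty_iff_eq_empty] at h0
    have hbot : isotypicComponent (MonoidAlgebra ℂ G) τ.asModule σ.asModule = ⊥ := by
      rw [isotypicComponent, h0, sSup_empty]
    exact top_ne_bot (htop.symm.trans hbot)
  obtain ⟨m, ⟨em⟩⟩ := hne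
  rcases eq_bot_or_eq_top m with hm | hm
  · exfalso
    subst hm
    haveI : Subsingleton σ.asModule := em.symm.toEquiv.subsingleton
    have hle : isotypicComponent (MonoidAlgebra ℂ G) τ.asModule σ.asModule ≤ ⊥ := by
      rw [isotypicComponent]
      refine sSup_le fun m' hm' => ?_
      obtain ⟨e'⟩ := hm'
      haveI : Subsingleton m' := e'.toEquiv.subsingleton
      exact (Submodule.eq_bot_of_subsingleton (p := m')).le
    have htb : (⊤ : Submodule (MonoidAlgebra ℂ G) τ.asModule) ≤ ⊥ := htop ▸ hle
    exact top_ne_bot (le_bot_iff.mp htb)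
  · subst hm
    let e : τ.asModule ≃ₗ[MonoidAlgebra ℂ G] σ.asModule := Submodule.topEquiv.symm.trans em
    let φ : τ.IntertwiningMap σ := (Representation.IntertwiningMap.equivLinearMapAsModule τ σ).symm e.toLinearMap
    have hφinj : Function.Injective φ.toLinearMap := fun a b h => e.injective h
    exact isUnitarizable_of_injective φ.toLinearMap (fun g t => Representation.IntertwiningMap.isIntertwining τ σ φ g t) hφinj hσ

/-- A representation is isotypic of its own type: `isotypicComponent ℂ[G] M M = ⊤`. [cite: BourbakiAlgebreVIII2012, VIII §4 n°2] -/
theorem isotypicComponent_self_eq_top {R M : Type*} [Ring R] [AddCommGroup M] [Module R M] : isotypicComponent R M M = ⊤ :=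
  top_le_iff.mp (((⊤ : Submodule R M).le_isotypicComponent).trans (LinearEquiv.isotypicComponent_eq (Submodule.topEquiv : _ ≃ₗ[R] M)).le)

/-- The restriction of a smooth representation along a continuous homomorphism is smooth (stabilisers pull back to open stabilisers).
[cite: BernsteinZelevinsky1976, §2.1] -/
theorem isSmooth_comp_of_continuous {k G H V : Type*} [CommRing k] [Group G] [Group H] [AddCommGroup V] [Module k V]
    [TopologicalSpace G] [TopologicalSpace H] {ρ : Representation k G V} (hρ : ρ.IsSmooth) (ι : H →* G) (hι : Continuous ι) :
    Representation.IsSmooth (show Representation k H V from ρ.comp ι) := fun v => by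
  have h : ((show Representation k H V from ρ.comp ι).stabilizerSubgroup v : Set H) = ι ⁻¹' (ρ.stabilizerSubgroup v : Set G) := by
    ext h
    simp [Representation.mem_stabilizerSubgroup]
  rw [Representation.isSmoothVector_iff, h]
  exact (hρ v).preimage hι

/-- **The rational diagonalising frame of `Φ₃`**: `S = (e₁+e₃ | e₂ | e₁−e₃) ∈ GL₃(ℚ) ⊂ GL₃(L)` has real non-zero entries and `ᵗS̄ · Φ₃ · S = diag(2, 1, −2)`
(a theta frame `(e₁, dV, g)` for `H = Φ₃` in the sense of ★ `ThetaTypeAtCM`). [cite: PlatonovRapinchuk1994, §2.3] [cite: Rogawski1990, §12.2 p. 173] -/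
theorem exists_qsFrame (L : Type) [Field L] [NumberField L] [IsCMField L] :
    ∃ (dV : Fin 3 → L) (g : GL (Fin 3) L), (∀ i, IsCMField.complexConj L (dV i) = dV i) ∧ (∀ i, dV i ≠ 0) ∧
      ((g : Matrix (Fin 3) (Fin 3) L).map (cmConjRingHom L))ᵀ * qsForm L * (g : Matrix (Fin 3) (Fin 3) L) = Matrix.diagonal dV := by
  have hdet : Matrix.det (!![1, 0, 1; 0, 1, 0; 1, 0, -1] : Matrix (Fin 3) (Fin 3) L) ≠ 0 := by
    rw [Matrix.det_fin_three]
    simp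
    norm_num
  refine ⟨![2, 1, -2], Matrix.GeneralLinearGroup.mkOfDetNeZero _ hdet, ?_, ?_, ?_⟩
  · intro i
    fin_cases i <;> simp
  · intro i
    fin_cases i <;> simp
  · have hmap : (!![1, 0, 1; 0, 1, 0; 1, 0, -1] : Matrix (Fin 3) (Fin 3) L).map (cmConjRingHom L) = !![1, 0, 1; 0, 1, 0; 1, 0, -1] := by
      ext i j
      fin_cases i <;> fin_cases j <;> simp
    rw [Matrix.GeneralLinearGroup.val_mkOfDetNeZero, hmap]
    ext i j
    fin_cases i <;> fin_cases j <;> simp [Matrix.mul_apply, Fin.sum_univ_three, Matrix.diagonal] <;> norm_num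

/-! ## §3 Clause (ii) by the theta road -/

section CM

variable (L : Type) [Field L] [NumberField L] [IsCMField L]

set_option synthInstance.maxHeartbeats 400000 in
set_option maxHeartbeats 8000000 in
/-- **`X_v(μ, ε, χ_f)` is UNITARIZABLE at a NON-split place** (from the stub TEXTS U1a′, U1b): the rank-one factor `U((ε))(L⁺_v) = L_w¹` is COMPACT at a non-split `v`
(★ `compactSpace_localPi_one_of_smul_eq`), `ω_v ∘ (local centre)` is smooth (★ `isSmooth_omegaLoc`, ★ `continuous_localCenter`), `ω_v` is unitarizable (U1a′ at the
unitary `θ = μ̃`, ★ `isUnitary_toHeckeCharacter`), so the `χ_{f,v}`-coinvariants are (U1b), and so is their restriction along ★ `localLineInl` (★ `isUnitarizable_comp`).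
[cite: Liu2021, Def. 4.11 (l. 2090–2096)] [cite: MoeglinVignerasWaldspurger1987, Ch. 2 II.2, Ch. 3 IV] -/
theorem xThetaCM_isUnitarizable
    (hU1a : ∀ (L : Type) [Field L] [NumberField L] [IsCMField L] {n' : ℕ} (e₁ : Fin 3 × Fin 1 ≃ Fin n')
      (dV : Fin 3 → L) (hdV : ∀ i, IsCMField.complexConj L (dV i) = dV i) (hdV0 : ∀ i, dV i ≠ 0)
      (θ : HeckeCharacter L) (hθ : IsSplittingChar L 1 θ) (hθu : θ.IsUnitary) (ε : (↥(maximalRealSubfield L))ˣ)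
      (v : HeightOneSpectrum (𝓞 ↥(maximalRealSubfield L))), ((chiLocalSplittingsCM L e₁ dV hdV hdV0 θ hθ ε).omegaLoc v).IsUnitarizable)
    (hU1b : ∀ {G H S : Type} [Group G] [Group H] [TopologicalSpace H] [IsTopologicalGroup H] [CompactSpace H]
      [AddCommGroup S] [Module ℂ S] {ρW : Representation ℂ H S} (χ : H →* ℂˣ) (ρV : Representation ℂ G S)
      (hc : ∀ (g : G) (h : H), Commute (ρV g) (ρW h)), ρW.IsSmooth → ρV.IsUnitarizable → (TwistedCoinv.rep χ ρV hc).IsUnitarizable)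
    {n' : ℕ} (e₁ : Fin 3 × Fin 1 ≃ Fin n') (dV : Fin 3 → L) (hdV : ∀ i, IsCMField.complexConj L (dV i) = dV i) (hdV0 : ∀ i, dV i ≠ 0)
    (μ : Literature.NumberTheory.Automorphic.IdeleClassGroup L →ₜ* Circle) (hμ : IsConjugateSymplectic L μ)
    (χf : UnitaryGroup.finAdelicOne (↥(maximalRealSubfield L)) L (IsCMField.complexConj L) →* ℂˣ) (ε : (↥(maximalRealSubfield L))ˣ)
    (v : HeightOneSpectrum (𝓞 ↥(maximalRealSubfield L))) (hns : ∀ w : PlacesOver L v, IsCMField.complexConj L • w.1 = w.1) :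
    (xThetaCM L e₁ dV hdV hdV0 μ hμ χf ε v).IsUnitarizable := by
  haveI : Algebra.IsQuadraticExtension ↥(maximalRealSubfield L) L := IsCMField.isQuadraticExtension L
  haveI : CompactSpace (localPi L (IsCMField.complexConj L) 1 (JW (↥(maximalRealSubfield L)) L ε) v) :=
    compactSpace_localPi_one_of_smul_eq (IsCMField.complexConj L) (JW (↥(maximalRealSubfield L)) L ε) (IsCMField.complexConj_ne_one L)
      (JW_apply_ne_zero (↥(maximalRealSubfield L)) L ε) (Classical.arbitrary (PlacesOver L v)) (hns _)
  exact isUnitarizable_comp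
    (hU1b _ _ (commute_omegaLoc_localCenter (↥(maximalRealSubfield L)) L (IsCMField.complexConj L) 3 e₁ (Matrix.diagonal dV)
        (JW (↥(maximalRealSubfield L)) L ε) (complexConj_imagUnit L) (imagUnit_ne_zero L) (imagUnit_mul_self L)
        (realDiagonal_isSymm L dV hdV) (isSymm_TW (↥(maximalRealSubfield L)) ε) (realDiagonal_map L dV hdV).symm
        (JW_eq (↥(maximalRealSubfield L)) L ε) (JW_apply_ne_zero (↥(maximalRealSubfield L)) L ε)
        (chiLocalSplittingsCM L e₁ dV hdV hdV0 (toHeckeCharacter L μ) ((isOscillatorChar_toHeckeCharacter_iff μ).mpr hμ) ε) v)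
      (isSmooth_comp_of_continuous
        ((chiLocalSplittingsCM L e₁ dV hdV hdV0 (toHeckeCharacter L μ) ((isOscillatorChar_toHeckeCharacter_iff μ).mpr hμ) ε).isSmooth_omegaLoc v)
        _ (continuous_localCenter L (IsCMField.complexConj L) n' _ (JW (↥(maximalRealSubfield L)) L ε)
          (JW_apply_ne_zero (↥(maximalRealSubfield L)) L ε) v))
      (hU1a L e₁ dV hdV hdV0 (toHeckeCharacter L μ) ((isOscillatorChar_toHeckeCharacter_iff μ).mpr hμ) (isUnitary_toHeckeCharacter L μ) ε v))
    _

set_option synthInstance.maxHeartbeats 400000 in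
set_option maxHeartbeats 8000000 in
/-- **THETA TYPE ⇒ UNITARIZABLE**: a class `c` of `U(H)(L⁺_v)` which is the theta type `X_v(μ, ε, χ_f) ∘ κ_v⁻¹` (★ `ThetaTypeAtCM`) is unitarizable as soon as
`X_v(μ, ε, χ_f)` is — read at a representative `r` of `c ∘ localPiEquiv` (★ `IrrClass.mk_surjective`; `r.ρ` is a constituent of itself, ★ `isConstituentOf_mk_self`,
and isotypic of its own type, §2), §2 `isUnitarizable_of_isIrreducible_of_isotypicComponent_eq_top`, and back along `localPiEquiv⁻¹` (★ `isUnitarizable_comap`,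
★ `IrrClass.comap_symm_comap`). [cite: GelbartRogawski1991, (5.1.1) p. 465, Lem. 5.1.2 p. 466] [cite: BushnellHenniart2006, §1.1, §2.6] -/
theorem isUnitarizable_of_thetaTypeAtCM {H : Matrix (Fin 3) (Fin 3) L} {n' : ℕ} {e₁ : Fin 3 × Fin 1 ≃ Fin n'} {dV : Fin 3 → L}
    {hdV : ∀ i, IsCMField.complexConj L (dV i) = dV i} {hdV0 : ∀ i, dV i ≠ 0} {g : GL (Fin 3) L}
    {hg : ((g : Matrix (Fin 3) (Fin 3) L).map (cmConjRingHom L))ᵀ * H * (g : Matrix (Fin 3) (Fin 3) L) = Matrix.diagonal dV}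
    {μ : Literature.NumberTheory.Automorphic.IdeleClassGroup L →ₜ* Circle} {hμ : IsConjugateSymplectic L μ}
    {χf : UnitaryGroup.finAdelicOne (↥(maximalRealSubfield L)) L (IsCMField.complexConj L) →* ℂˣ} {ε : (↥(maximalRealSubfield L))ˣ}
    {v : HeightOneSpectrum (𝓞 ↥(maximalRealSubfield L))} {c : IrrClass ((cmDatum L 3 H).Local v)}
    (hθ : ThetaTypeAtCM L H e₁ dV hdV hdV0 g hg μ hμ χf ε v c) (hX : (xThetaCM L e₁ dV hdV hdV0 μ hμ χf ε v).IsUnitarizable) :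
    c.IsUnitarizable := by
  obtain ⟨r, hr⟩ := IrrClass.mk_surjective (IrrClass.comap (localPiEquiv L (IsCMField.complexConj L) 3 H v) c)
  have htop := hθ r.V r.ρ r.isIrreducible (hr ▸ IrrClass.isConstituentOf_mk_self r) r.V r.ρ isotypicComponent_self_eq_top
  have hr_u : r.ρ.IsUnitarizable :=
    isUnitarizable_of_isIrreducible_of_isotypicComponent_eq_top r.isIrreducible htop (isUnitarizable_comp hX _)
  have h1 : (IrrClass.comap (localPiEquiv L (IsCMField.complexConj L) 3 H v) c).IsUnitarizable :=
    hr ▸ (IrrClass.isUnitarizable_mk r).2 hr_u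
  rw [← IrrClass.comap_symm_comap (localPiEquiv L (IsCMField.complexConj L) 3 H v) c]
  exact isUnitarizable_comap _ h1

variable (H : Matrix (Fin 3) (Fin 3) L) (hH : (H.map (cmConjRingHom L))ᵀ = H) (hHd : IsUnit H.det) (μω : HeckeCharacter L) (hμu : μω.IsUnitary)
  (hres : ∀ x : Literature.NumberTheory.GaloisRepresentations.ideleGroup ↥(maximalRealSubfield L),
    μω (AdeleRing.ideleBaseChange (↥(maximalRealSubfield L)) L x) = quadraticHeckeCharCM L x)
  [∀ v : HeightOneSpectrum (𝓞 ↥(maximalRealSubfield L)), MeasurableSpace (Gqs L v ⧸ Subgroup.center (Gqs L v))]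
  [∀ v : HeightOneSpectrum (𝓞 ↥(maximalRealSubfield L)), BorelSpace (Gqs L v ⧸ Subgroup.center (Gqs L v))]
  (μZ : ∀ v : HeightOneSpectrum (𝓞 ↥(maximalRealSubfield L)), Measure (Gqs L v ⧸ Subgroup.center (Gqs L v)))
  [∀ v : HeightOneSpectrum (𝓞 ↥(maximalRealSubfield L)), (μZ v).IsHaarMeasure]
  (keys : ∀ (ξ : OneDimAutRepH L) (v : HeightOneSpectrum (𝓞 ↥(maximalRealSubfield L))),
    (∀ w : PlacesOver L v, IsCMField.complexConj L • w.1 = w.1) →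
      {p : IrrClass (Gqs L v) × IrrClass (Gqs L v) //
        KeysCaseTwoLabels L v (μω.semilocalComponent L v) (torusLocalComponent L (IsCMField.complexConj L) v ξ.η)
          (torusLocalComponent L (IsCMField.complexConj L) v ξ.ψ) p.1 p.2 ∧
        p.1.IsSquareIntegrable (μZ v) ∧ ¬ p.2.IsSquareIntegrable (μZ v)})

include hμu hres

set_option synthInstance.maxHeartbeats 400000 in
set_option maxHeartbeats 8000000 in
/-- **CLAUSE (ii) FROM THE STUB TEXTS — the Keys-labelled `πⁿ(ξ_v)` is UNITARIZABLE at a non-split `v`** (Haar frame, `μω|_{𝕀_{L⁺}} = ω`): letter D at the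
label for `H = Φ₃` and the rational frame of §2 (`T = 1`, `a = 1`, ★ `formCongr_one_eq`) with the dictionary pair `(grdMu, grdChi)` ★ gives
`ThetaTypeAtCM … εn v (πⁿ ∘ e)`; `X_v(μ, εn, χ_f)` is unitarizable (`xThetaCM_isUnitarizable`); hence `πⁿ ∘ e` (`isUnitarizable_of_thetaTypeAtCM`) and `πⁿ`
(★ `isUnitarizable_comap`, ★ `IrrClass.comap_comap_symm`). [cite: GelbartRogawski1991, §1.4 p. 450, Lem. 5.1.2 p. 466] [cite: Rogawski1990, §12.2 (2) p. 174] -/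
theorem keysPn_isUnitarizable_of_stubs (hD : xiLocalPacket_nonsplit_isThetaPair)
    (hU1a : ∀ (L : Type) [Field L] [NumberField L] [IsCMField L] {n' : ℕ} (e₁ : Fin 3 × Fin 1 ≃ Fin n')
      (dV : Fin 3 → L) (hdV : ∀ i, IsCMField.complexConj L (dV i) = dV i) (hdV0 : ∀ i, dV i ≠ 0)
      (θ : HeckeCharacter L) (hθ : IsSplittingChar L 1 θ) (hθu : θ.IsUnitary) (ε : (↥(maximalRealSubfield L))ˣ)
      (v : HeightOneSpectrum (𝓞 ↥(maximalRealSubfield L))), ((chiLocalSplittingsCM L e₁ dV hdV hdV0 θ hθ ε).omegaLoc v).IsUnitarizable)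
    (hU1b : ∀ {G H S : Type} [Group G] [Group H] [TopologicalSpace H] [IsTopologicalGroup H] [CompactSpace H]
      [AddCommGroup S] [Module ℂ S] {ρW : Representation ℂ H S} (χ : H →* ℂˣ) (ρV : Representation ℂ G S)
      (hc : ∀ (g : G) (h : H), Commute (ρV g) (ρW h)), ρW.IsSmooth → ρV.IsUnitarizable → (TwistedCoinv.rep χ ρV hc).IsUnitarizable)
    (ξ : OneDimAutRepH L) (v : HeightOneSpectrum (𝓞 ↥(maximalRealSubfield L))) (hns : ∀ w : PlacesOver L v, IsCMField.complexConj L • w.1 = w.1) :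
    ((keys ξ v hns).1.2).IsUnitarizable := by
  obtain ⟨dV₀, S, hdV₀, hdV₀0, hS⟩ := exists_qsFrame L
  have hcong : formCongr (conjLocal L (IsCMField.complexConj L) v) (1 : GL (Fin 3) (UnitaryGroup.LocalRing L v))
      ((qsForm L).map (algebraMap L (UnitaryGroup.LocalRing L v))) =
      (1 : UnitaryGroup.LocalRing L v) • (Matrix.of fun i j : Fin 3 => if i.val + j.val + 1 = 3 then (1 : L) else 0).map
        (algebraMap L (UnitaryGroup.LocalRing L v)) := by
    rw [formCongr_one_eq, one_smul]
  obtain ⟨εn, hθ⟩ := hD.pin_of_keysLabels L (qsForm L) (antidiagOne_isHermitian L 3) (isUnit_antidiagOne_det L 3)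
    (Equiv.prodUnique (Fin 3) (Fin 1)) dV₀ hdV₀ hdV₀0 S hS ξ μω hμu hres (grdMu L ξ μω hμu) (isConjugateSymplectic_grdMu L ξ μω hμu hres)
    (grdChi L ξ μω hres) (continuous_grdChi L ξ μω hres) (norm_grdChi_apply L ξ hμu hres) (semilocalComponent_toHeckeCharacter_grdMu L ξ μω hμu)
    (fun z => grdChi_finAdelicCheck L ξ μω hres _ z) v hns 1 1 isUnit_one hcong (μZ v) (keys ξ v hns).1.1 (keys ξ v hns).1.2
    (keys ξ v hns).2.1 (keys ξ v hns).2.2.1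
  have hX := xThetaCM_isUnitarizable L hU1a hU1b (Equiv.prodUnique (Fin 3) (Fin 1)) dV₀ hdV₀ hdV₀0 (grdMu L ξ μω hμu)
    (isConjugateSymplectic_grdMu L ξ μω hμu hres) (grdChi L ξ μω hres) εn v hns
  have hc := isUnitarizable_of_thetaTypeAtCM L hθ hX
  rw [← IrrClass.comap_comap_symm (cmDatumLocalCongr L v 1 isUnit_one hcong) (keys ξ v hns).1.2]
  exact isUnitarizable_comap _ hc

/-! ## §4 The kernel-checked composition: the LETTER `XiLocalPacketUnitary` BY NAME, from the stub texts -/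

set_option synthInstance.maxHeartbeats 400000 in
set_option maxHeartbeats 8000000 in
/-- **`XiLocalPacketUnitary` FROM THE STUB TEXTS** (composition, no `sorry`): clause (i) = ★ p825402 transported along `cmSplitEquiv` (★ `cmSplitPacket_πn`,
★ `IrrClass.comap_mk`, ★ `isUnitarizable_comap`) — L1 ED. 5 §2 verbatim; clause (iii) = ★ p825442 at the frame ★ p825600 + ★ `forall_mem_center_cmLocal_eq_scalar`;
clause (ii) = §3 `keysPn_isUnitarizable_of_stubs`. [cite: Rogawski1990, §12.2 (1)–(2) pp. 173–174; §13.1 Prop. 13.1.3 (d) p. 199] [cite: GelbartRogawski1991, Lem. 5.1.2 p. 466] -/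
theorem xiLocalPacketUnitary_of_stubs (hD : xiLocalPacket_nonsplit_isThetaPair)
    (hU1a : ∀ (L : Type) [Field L] [NumberField L] [IsCMField L] {n' : ℕ} (e₁ : Fin 3 × Fin 1 ≃ Fin n')
      (dV : Fin 3 → L) (hdV : ∀ i, IsCMField.complexConj L (dV i) = dV i) (hdV0 : ∀ i, dV i ≠ 0)
      (θ : HeckeCharacter L) (hθ : IsSplittingChar L 1 θ) (hθu : θ.IsUnitary) (ε : (↥(maximalRealSubfield L))ˣ)
      (v : HeightOneSpectrum (𝓞 ↥(maximalRealSubfield L))), ((chiLocalSplittingsCM L e₁ dV hdV hdV0 θ hθ ε).omegaLoc v).IsUnitarizable)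
    (hU1b : ∀ {G H S : Type} [Group G] [Group H] [TopologicalSpace H] [IsTopologicalGroup H] [CompactSpace H]
      [AddCommGroup S] [Module ℂ S] {ρW : Representation ℂ H S} (χ : H →* ℂˣ) (ρV : Representation ℂ G S)
      (hc : ∀ (g : G) (h : H), Commute (ρV g) (ρW h)), ρW.IsSmooth → ρV.IsUnitarizable → (TwistedCoinv.rep χ ρV hc).IsUnitarizable) :
    XiLocalPacketUnitary L H hH hHd μω hμu μZ keys := by
  refine ⟨fun ξ v hs => ?_, fun ξ v hns => keysPn_isUnitarizable_of_stubs L μω hμu hres μZ keys hD hU1a hU1b ξ v hns, fun v hns c hc => ?_⟩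
  · rw [cmSplitPacket_πn, ← IrrClass.comap_mk]
    exact isUnitarizable_comap _ ((IrrClass.isUnitarizable_mk _).2
      (F0P3bSplitMemberUnitarizable.splitMemberGL_isUnitarizable _ _ _ _ _ _ _))   -- ★ p825402
  · obtain ⟨⟨K₀, hK₀o, hK₀c⟩, hZ⟩ := F0P3bLocalNonsplitCompactCenter.local_nonsplit_compactOpen_center_of_center_le L 3 H hHd v hns
      (UnitaryGroup.forall_mem_center_cmLocal_eq_scalar L H hH hHd v hns)   -- ★ p825600 + ★ `LocalUnitaryGroupCenter`
    exact F0P3bSupercuspidalUnitarizable.isUnitarizable_of_isSupercuspidal hK₀o hK₀c hZ c hc   -- ★ p825442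

/-- **THE HEAD — the letter `XiLocalPacketUnitary` at the three stubs of THIS file** (what the K9β junction consumes in place of `stub_XLPU`, with its `hμω` for `hres`
and its `haveI` Borel ∕ Haar instances): `sorry`-free; axioms the TRIO since ED. 5 (all three stubs closed by ★ names).
[cite: Rogawski1990, §12.2 (1)–(2) pp. 173–174; §13.1 Prop. 13.1.3 (d) p. 199] [cite: GelbartRogawski1991, Lem. 5.1.2 p. 466] -/
theorem xiLocalPacketUnitary_of_line : XiLocalPacketUnitary L H hH hHd μω hμu μZ keys :=
  xiLocalPacketUnitary_of_stubs L H hH hHd μω hμu hres μZ keys stub_GR91_localThetaPair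
    (fun L _ _ _ _ e₁ dV hdV hdV0 θ hθ hθu ε v => stub_isUnitarizable_omegaLocCM L e₁ dV hdV hdV0 θ hθ hθu ε v)
    (fun χ ρV hc hsm hρV => stub_isUnitarizable_twistedCoinv χ ρV hc hsm hρV)

end CM

/-! ## §5 The closed form (all frames at once; RULING (V46)∕(V47): a pay-down file ends with `def <Letter>Closed : Prop` + `theorem <letter>_closed`) -/

/-- **`XiLocalPacketUnitaryOfLineClosed` — the letter over ALL Haar frames with `μω|_{𝕀_{L⁺}} = ω`** (Prop-valued, no data): character-for-character the telescope of
K9β's `StubXLPU` (`Lines/F0_U3LettersRung1.lean` ED. 4 §C) with the junction's two extras inserted — `hres` after `hμu`; `BorelSpace` ∕ `IsHaarMeasure` instance binders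
around `μZ`. [cite: Rogawski1990, §12.2 (1)–(2) pp. 173–174; §13.1 Prop. 13.1.3 (d) p. 199] [cite: GelbartRogawski1991, Lem. 5.1.2 p. 466] -/
def XiLocalPacketUnitaryOfLineClosed : Prop :=
  ∀ (L : Type) [Field L] [NumberField L] [IsCMField L] (H : Matrix (Fin 3) (Fin 3) L)
    (hH : (H.map (cmConjRingHom L))ᵀ = H) (hHd : IsUnit H.det) (μω : HeckeCharacter L) (hμu : μω.IsUnitary),
    (∀ x : Literature.NumberTheory.GaloisRepresentations.ideleGroup ↥(maximalRealSubfield L),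
        μω (AdeleRing.ideleBaseChange (↥(maximalRealSubfield L)) L x) = quadraticHeckeCharCM L x) →
    ∀ [∀ v : HeightOneSpectrum (𝓞 ↥(maximalRealSubfield L)), MeasurableSpace (Gqs L v ⧸ Subgroup.center (Gqs L v))]
      [∀ v : HeightOneSpectrum (𝓞 ↥(maximalRealSubfield L)), BorelSpace (Gqs L v ⧸ Subgroup.center (Gqs L v))]
      (μZ : ∀ v : HeightOneSpectrum (𝓞 ↥(maximalRealSubfield L)), Measure (Gqs L v ⧸ Subgroup.center (Gqs L v)))
      [∀ v : HeightOneSpectrum (𝓞 ↥(maximalRealSubfield L)), (μZ v).IsHaarMeasure]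
      (keys : ∀ (ξ : OneDimAutRepH L) (v : HeightOneSpectrum (𝓞 ↥(maximalRealSubfield L))),
        (∀ w : PlacesOver L v, IsCMField.complexConj L • w.1 = w.1) →
          {p : IrrClass (Gqs L v) × IrrClass (Gqs L v) //
            KeysCaseTwoLabels L v (μω.semilocalComponent L v) (torusLocalComponent L (IsCMField.complexConj L) v ξ.η)
              (torusLocalComponent L (IsCMField.complexConj L) v ξ.ψ) p.1 p.2 ∧
            p.1.IsSquareIntegrable (μZ v) ∧ ¬ p.2.IsSquareIntegrable (μZ v)}),
      XiLocalPacketUnitary L H hH hHd μω hμu μZ keys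

/-- **The closed form holds at the three stubs of this file** (`sorry`-free; axioms the TRIO since ED. 5 — all three stubs closed by ★ names).
[cite: Rogawski1990, §12.2 (1)–(2) pp. 173–174; §13.1 Prop. 13.1.3 (d) p. 199] [cite: GelbartRogawski1991, Lem. 5.1.2 p. 466] -/
theorem xiLocalPacketUnitary_of_line_closed : XiLocalPacketUnitaryOfLineClosed :=
  fun L _ _ _ H hH hHd μω hμu hres _ _ μZ _ keys => xiLocalPacketUnitary_of_line L H hH hHd μω hμu hres μZ keys

end Summit.HodgeConjecture.HodgeConjecture.Cruxes.H413.F0P3bKeysPnUnitaryPaydown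

end
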